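import Literature.Geometry.Lorentzian.KerrSchildMultiplierCurrent
import Literature.Geometry.Lorentzian.MinkowskiRadialMultiplier
import Literature.Geometry.Lorentzian.KerrConvergence
import Summits.FinalStateConjecture.FinalStateConjecture.Theorems.ClusterCompletenessAdiabaticMultiKerrILEDZoneDivergence
import Summits.FinalStateConjecture.FinalStateConjecture.Theorems.ClusterCompletenessAdiabaticMultiKerrILEDBoostedZoneTerm

/-! # Route ClusterCompleteness — crux `AdiabaticMultiKerrILED`: homothety divergence on one
# boosted tails-cut Schwarzschild zone

Helper file for the crux `stmt-FinalStateConjecture-14310` (line `Sketch`, lead c6 wave 4, card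
milne-hubble-current): for ONE boosted, tails-cut Schwarzschild zone `G₁ = η − T`,
`T(y)^{αβ} = χ(r) · 2H · (Λℓ♯)^α (Λℓ♯)^β` evaluated at the rest-frame point
`q y = poincareInv Λ c y = Λ⁻¹(y − c)` (`c = (0, p)`, `a = 0`, `r = Kerr.radius 0 (q y)`,
`H = M/r`, `χ(r) = Real.smoothTransition (2 − r/(8M))`), and the homothety `S = (x − x₀)·∂`
centred at an ARBITRARY event `x₀`, the divergence of the conformally corrected current
`J^S + ¼ L₄` is
`(S(w) + w) □_{G₁} w − (χ − r χ') H ((Λℓ♯)·dw)² + ½ ∑_{αβ} dT^{αβ}(x)[c − x₀] ∂_αw ∂_βw`: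
the general `η − F` identity (`zoneDiv_sum_fderiv_homothetyCurrent_eta_sub`), the split of the
direction `x − x₀ = (x − c) + (c − x₀)` (linearity of `dT(x)`), and Euler's identity about the
centre `dT(x)[x − c] = (r χ' − χ) · 2H · (Λℓ♯) ⊗ (Λℓ♯)` (`fderiv_cruxTerm_self_schwarzschild`).
[folklore] -/

noncomputable section

-- the doubled `FinalStateConjecture.FinalStateConjecture` path component trips dupNamespace
set_option linter.dupNamespace false

open scoped BigOperators
open Literature.Geometry.Lorentzian

namespace Summit.FinalStateConjecture.FinalStateConjecture.Theorems

/-- Splitting the direction of a derivative at `x` through two intermediate events: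
`φ x = φ (x − c) + φ (c − x₀) + ∑_μ x₀^μ φ(∂_μ)` for a linear `φ` (`x = (x − c) + (c − x₀) + x₀`
and `x₀ = ∑_μ x₀^μ ∂_μ`). [folklore] -/
theorem boostedDiv_clm_apply_split (φ : E4 →L[ℝ] ℝ) (x c x₀ : E4) :
    φ x = φ (x - c) + φ (c - x₀) + ∑ μ, x₀ μ * φ (E4.basisVector μ) := by
  rw [← zoneDiv_clm_apply_eq_sum, ← map_add, ← map_add, sub_add_sub_cancel, sub_add_cancel]

/-- **The homothety divergence on one boosted tails-cut Schwarzschild zone.** For the crux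
background `G₁ = η − T` with the BOOSTED `a = 0` zone term
`T(y)^{αβ} = χ(r) · 2H · (Λℓ♯)^α (Λℓ♯)^β` (evaluated at `q y = Λ⁻¹(y − c)`, `c = (0, p)`), the
homothety `S = (x − x₀)·∂` centred at an arbitrary event `x₀`, a point `x` with `r(q x) > 0` and
`w` of class `C²` at `x`,
`∑_μ ∂_μ (J^S + ¼ L₄)^μ = (S(w) + w) □_{G₁} w − (χ − r χ') H ((Λℓ♯)·dw)²
  + ½ ∑_{αβ} dT^{αβ}(x)[c − x₀] ∂_αw ∂_βw`:
`zoneDiv_sum_fderiv_homothetyCurrent_eta_sub` (with `T` differentiable at `x`,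
`boostedZone_differentiableAt_cruxTerm`, and symmetric), the split
`dT(x)[x] = dT(x)[x − c] + dT(x)[c − x₀] + ∑_μ x₀^μ ∂_μT` (`boostedDiv_clm_apply_split`), the
pumping identity `dT(x)[x − c] = (r χ' − χ) · 2H · (Λℓ♯)^α (Λℓ♯)^β`
(`fderiv_cruxTerm_self_schwarzschild`) and `∑_{αβ} (Λℓ♯)^α (Λℓ♯)^β ∂_αw ∂_βw = ((Λℓ♯)·dw)²`.
[folklore] -/
theorem sum_fderiv_homothetyCurrent_cruxZone_boosted : ∀ (M : ℝ) (Λ : lorentzGroup) (p : E3) (x₀ : E4) (w : E4 → ℝ) (x : E4) (hx : 0 < Kerr.radius 0 (poincareInv Λ (E4.ofTimeSpace 0 p) x)) (hw : ContDiffAt ℝ 2 w x), ∑ μ, fderiv ℝ (fun y ↦ KerrSchild.multiplierCurrent (fun z α β ↦ Kerr.etaComp α β - Real.smoothTransition (2 - Kerr.radius 0 (poincareInv Λ (E4.ofTimeSpace 0 p) z) / (8 * M)) * (2 * Kerr.scalarH M 0 (poincareInv Λ (E4.ofTimeSpace 0 p) z)) * ((Λ : E4 ≃L[ℝ] E4)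 (Kerr.nullVector 0 (poincareInv Λ (E4.ofTimeSpace 0 p) z))) α * ((Λ : E4 ≃L[ℝ] E4) (Kerr.nullVector 0 (poincareInv Λ (E4.ofTimeSpace 0 p) z))) β) (fun z α ↦ z α - x₀ α) w y μ + 4⁻¹ * KerrSchild.lagrangianCurrent (fun z α β ↦ Kerr.etaComp α β - Real.smoothTransition (2 - Kerr.radius 0 (poincareInv Λ (E4.ofTimeSpace 0 p) z) / (8 * M)) * (2 * Kerr.scalarH M 0 (poincareInv Λ (E4.ofTimeSpace 0 p) z)) * ((Λ : E4 ≃L[ℝ] E4) (Kerr.nullVector 0 (poincareInv Λ (E4.ofTimeSpace 0 p) z))) α * ((Λ : E4 ≃L[ℝ] E4) (Kerr.nullVector 0 (poincareInv Λ (E4.ofTimeSpace 0 p) z))) β) (fun _ ↦ (4 : ℝ)) w y μ) x (E4.basisVector μ) = ((∑ α, (x α - x₀ α) * fderiv ℝ w x (E4.basisVector α)) + w x) * KerrSchild.waveOperator (fun z α β ↦ Kerr.etaComp α β - Real.smoothTransition (2 - Kerr.radius 0 (poincareInv Λ (E4.ofTimeSpace 0 p) z) / (8 * M)) * (2 * Kerr.scalarH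 M 0 (poincareInv Λ (E4.ofTimeSpace 0 p) z)) * ((Λ : E4 ≃L[ℝ] E4) (Kerr.nullVector 0 (poincareInv Λ (E4.ofTimeSpace 0 p) z))) α * ((Λ : E4 ≃L[ℝ] E4) (Kerr.nullVector 0 (poincareInv Λ (E4.ofTimeSpace 0 p) z))) β) w x - (Real.smoothTransition (2 - Kerr.radius 0 (poincareInv Λ (E4.ofTimeSpace 0 p) x) / (8 * M)) - Kerr.radius 0 (poincareInv Λ (E4.ofTimeSpace 0 p) x) * deriv (fun s ↦ Real.smoothTransition (2 - s / (8 * M))) (Kerr.radius 0 (poincareInv Λ (E4.ofTimeSpace 0 p) x))) * Kerr.scalarH M 0 (poincareInv Λ (E4.ofTimeSpace 0 p) x) * (∑ α, ((Λ : E4 ≃L[ℝ] E4) (Kerr.nullVector 0 (poincareInv Λ (E4.ofTimeSpace 0 p) x))) α * fderiv ℝ w x (E4.basisVector α)) ^ 2 + 2⁻¹ * ∑ α, ∑ β, fderiv ℝ (fun y ↦ Real.smoothTransition (2 - Kerr.radius 0 (poincareInv Λ (E4.ofTimeSpace 0 p) y) / (8 * M)) * (2 * Kerr.scalarH M 0 (poincareInv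 Λ (E4.ofTimeSpace 0 p) y)) * ((Λ : E4 ≃L[ℝ] E4) (Kerr.nullVector 0 (poincareInv Λ (E4.ofTimeSpace 0 p) y))) α * ((Λ : E4 ≃L[ℝ] E4) (Kerr.nullVector 0 (poincareInv Λ (E4.ofTimeSpace 0 p) y))) β) x (E4.ofTimeSpace 0 p - x₀) * fderiv ℝ w x (E4.basisVector α) * fderiv ℝ w x (E4.basisVector β) := by
  intro M Λ p x₀ w x hx hw
  have hF : ∀ μ ν, DifferentiableAt ℝ (fun y ↦
      Real.smoothTransition (2 - Kerr.radius 0 (poincareInv Λ (E4.ofTimeSpace 0 p) y) / (8 * M)) *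
        (2 * Kerr.scalarH M 0 (poincareInv Λ (E4.ofTimeSpace 0 p) y)) *
        ((Λ : E4 ≃L[ℝ] E4) (Kerr.nullVector 0 (poincareInv Λ (E4.ofTimeSpace 0 p) y))) μ *
        ((Λ : E4 ≃L[ℝ] E4) (Kerr.nullVector 0 (poincareInv Λ (E4.ofTimeSpace 0 p) y))) ν) x :=
    fun μ ν ↦ boostedZone_differentiableAt_cruxTerm M 0 Λ (E4.ofTimeSpace 0 p) hx μ ν
  have hsymm : ∀ μ ν,
      Real.smoothTransition (2 - Kerr.radius 0 (poincareInv Λ (E4.ofTimeSpace 0 p) x) / (8 * M)) *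
          (2 * Kerr.scalarH M 0 (poincareInv Λ (E4.ofTimeSpace 0 p) x)) *
          ((Λ : E4 ≃L[ℝ] E4) (Kerr.nullVector 0 (poincareInv Λ (E4.ofTimeSpace 0 p) x))) μ *
          ((Λ : E4 ≃L[ℝ] E4) (Kerr.nullVector 0 (poincareInv Λ (E4.ofTimeSpace 0 p) x))) ν =
        Real.smoothTransition (2 - Kerr.radius 0 (poincareInv Λ (E4.ofTimeSpace 0 p) x) / (8 * M)) *
          (2 * Kerr.scalarH M 0 (poincareInv Λ (E4.ofTimeSpace 0 p) x)) *
          ((Λ : E4 ≃L[ℝ] E4) (Kerr.nullVector 0 (poincareInv Λ (E4.ofTimeSpace 0 p) x))) ν *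
          ((Λ : E4 ≃L[ℝ] E4) (Kerr.nullVector 0 (poincareInv Λ (E4.ofTimeSpace 0 p) x))) μ :=
    fun μ ν ↦ by ring
  rw [zoneDiv_sum_fderiv_homothetyCurrent_eta_sub (fun (z : E4) (α β : Fin 4) ↦
    Real.smoothTransition (2 - Kerr.radius 0 (poincareInv Λ (E4.ofTimeSpace 0 p) z) / (8 * M)) *
      (2 * Kerr.scalarH M 0 (poincareInv Λ (E4.ofTimeSpace 0 p) z)) *
      ((Λ : E4 ≃L[ℝ] E4) (Kerr.nullVector 0 (poincareInv Λ (E4.ofTimeSpace 0 p) z))) α *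
      ((Λ : E4 ≃L[ℝ] E4) (Kerr.nullVector 0 (poincareInv Λ (E4.ofTimeSpace 0 p) z))) β)
    x₀ w x hF hsymm hw]
  beta_reduce
  -- split the radial direction `x = (x − c) + (c − x₀) + x₀` and pump along `x − c`
  have hsplit : ∀ α β, fderiv ℝ (fun y ↦
      Real.smoothTransition (2 - Kerr.radius 0 (poincareInv Λ (E4.ofTimeSpace 0 p) y) / (8 * M)) *
        (2 * Kerr.scalarH M 0 (poincareInv Λ (E4.ofTimeSpace 0 p) y)) *
        ((Λ : E4 ≃L[ℝ] E4) (Kerr.nullVector 0 (poincareInv Λ (E4.ofTimeSpace 0 p) y))) α *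
        ((Λ : E4 ≃L[ℝ] E4) (Kerr.nullVector 0 (poincareInv Λ (E4.ofTimeSpace 0 p) y))) β) x x =
      (Kerr.radius 0 (poincareInv Λ (E4.ofTimeSpace 0 p) x) *
            deriv (fun s ↦ Real.smoothTransition (2 - s / (8 * M)))
              (Kerr.radius 0 (poincareInv Λ (E4.ofTimeSpace 0 p) x)) -
          Real.smoothTransition
            (2 - Kerr.radius 0 (poincareInv Λ (E4.ofTimeSpace 0 p) x) / (8 * M))) *
        (2 * Kerr.scalarH M 0 (poincareInv Λ (E4.ofTimeSpace 0 p) x)) *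
        ((Λ : E4 ≃L[ℝ] E4) (Kerr.nullVector 0 (poincareInv Λ (E4.ofTimeSpace 0 p) x))) α *
        ((Λ : E4 ≃L[ℝ] E4) (Kerr.nullVector 0 (poincareInv Λ (E4.ofTimeSpace 0 p) x))) β +
      fderiv ℝ (fun y ↦
        Real.smoothTransition
            (2 - Kerr.radius 0 (poincareInv Λ (E4.ofTimeSpace 0 p) y) / (8 * M)) *
          (2 * Kerr.scalarH M 0 (poincareInv Λ (E4.ofTimeSpace 0 p) y)) *
          ((Λ : E4 ≃L[ℝ] E4) (Kerr.nullVector 0 (poincareInv Λ (E4.ofTimeSpace 0 p) y))) α *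
          ((Λ : E4 ≃L[ℝ] E4) (Kerr.nullVector 0 (poincareInv Λ (E4.ofTimeSpace 0 p) y))) β) x
        (E4.ofTimeSpace 0 p - x₀) +
      ∑ μ, x₀ μ * fderiv ℝ (fun y ↦
        Real.smoothTransition
            (2 - Kerr.radius 0 (poincareInv Λ (E4.ofTimeSpace 0 p) y) / (8 * M)) *
          (2 * Kerr.scalarH M 0 (poincareInv Λ (E4.ofTimeSpace 0 p) y)) *
          ((Λ : E4 ≃L[ℝ] E4) (Kerr.nullVector 0 (poincareInv Λ (E4.ofTimeSpace 0 p) y))) α *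
          ((Λ : E4 ≃L[ℝ] E4) (Kerr.nullVector 0 (poincareInv Λ (E4.ofTimeSpace 0 p) y))) β) x
        (E4.basisVector μ) := by
    intro α β
    rw [← fderiv_cruxTerm_self_schwarzschild M Λ p x hx α β]
    exact boostedDiv_clm_apply_split _ x (E4.ofTimeSpace 0 p) x₀
  simp only [hsplit]
  -- name the atoms and expand the finite sums
  obtain ⟨P, hP⟩ : ∃ P : Fin 4 → ℝ, ∀ β, fderiv ℝ w x (E4.basisVector β) = P β :=
    ⟨_, fun _ ↦ rfl⟩
  obtain ⟨dF, hdF⟩ : ∃ dF : Fin 4 → Fin 4 → Fin 4 → ℝ, ∀ μ α β,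
      fderiv ℝ (fun y ↦
        Real.smoothTransition
            (2 - Kerr.radius 0 (poincareInv Λ (E4.ofTimeSpace 0 p) y) / (8 * M)) *
          (2 * Kerr.scalarH M 0 (poincareInv Λ (E4.ofTimeSpace 0 p) y)) *
          ((Λ : E4 ≃L[ℝ] E4) (Kerr.nullVector 0 (poincareInv Λ (E4.ofTimeSpace 0 p) y))) α *
          ((Λ : E4 ≃L[ℝ] E4) (Kerr.nullVector 0 (poincareInv Λ (E4.ofTimeSpace 0 p) y))) β) x
        (E4.basisVector μ) = dF μ α β := ⟨_, fun _ _ _ ↦ rfl⟩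
  obtain ⟨dC, hdC⟩ : ∃ dC : Fin 4 → Fin 4 → ℝ, ∀ α β,
      fderiv ℝ (fun y ↦
        Real.smoothTransition
            (2 - Kerr.radius 0 (poincareInv Λ (E4.ofTimeSpace 0 p) y) / (8 * M)) *
          (2 * Kerr.scalarH M 0 (poincareInv Λ (E4.ofTimeSpace 0 p) y)) *
          ((Λ : E4 ≃L[ℝ] E4) (Kerr.nullVector 0 (poincareInv Λ (E4.ofTimeSpace 0 p) y))) α *
          ((Λ : E4 ≃L[ℝ] E4) (Kerr.nullVector 0 (poincareInv Λ (E4.ofTimeSpace 0 p) y))) β) x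
        (E4.ofTimeSpace 0 p - x₀) = dC α β := ⟨_, fun _ _ ↦ rfl⟩
  obtain ⟨L, hL⟩ : ∃ L : Fin 4 → ℝ, ∀ κ,
      ((Λ : E4 ≃L[ℝ] E4) (Kerr.nullVector 0 (poincareInv Λ (E4.ofTimeSpace 0 p) x))) κ = L κ :=
    ⟨_, fun _ ↦ rfl⟩
  simp only [hP, hdF, hdC, hL]
  simp only [Fin.sum_univ_four, Fin.isValue]
  ring

end Summit.FinalStateConjecture.FinalStateConjecture.Theorems
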